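import Literature.NumberTheory.LFunctions.ExceptionalPrimesHyperbola
import HarnessLib

/-!
# Multiplicative combinatorics of a non-negative multiplicative weight: products with primes
# from a window, the one-prime sieve, and elementary symmetric means

Topic `Literature/NumberTheory/LFunctions`. Everything in this file is PROVED (theorems only);
fourth support file of the elementary proof of Heath-Brown's lemma on exceptional primes
(`ExceptionalPrimesSparse.lean`). The statements concern an arbitrary multiplicative
`g : ArithmeticFunction ℝ` with `g ≥ 0` (in the application `g(n) = (1∗χ)(n) n^{-β}`) and are
the rigorous form of the "non-negativity and multiplicativity of `1 ∗ χ`" step in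
Tao–Teräväinen's proof of their Proposition 3.5:

* `sum_Icc_mul_one_add_sum_prime_le` — `G(Y) (1 + ∑_{Y<p≤Z} g(p)) ≤ G(YZ)`,
  `G(Y) = ∑_{n≤Y} g(n)` (the products `n·p`, `n ≤ Y < p`, are distinct and exceed `Y`);
* `sum_free_mul_esymm_le` — for a finite set `R` of primes and `m`-element subsets `P ⊆ R` with
  `∏ P > Y` and `n ∏ P ≤ U` (`n ≤ Y`): `(∑_{n ≤ Y, R-free} g(n)) · e_m(g; R) ≤ ∑_{Y<N≤U} g(N)`,
  `e_m(g; R) = ∑_{P ⊆ R, |P| = m} ∏_{p∈P} g(p)` (the products `n ∏ P` with `n` free of primes of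
  `R` are distinct — this is the injectivity missing in the printed display of Tao–Teräväinen);
* `sum_filter_dvd_le` — the one-prime sieve `∑_{n≤Y, p∣n} g(n) ≤ (∑_{1≤k≤Y} g(p^k)) G(Y)`;
  `sum_free_ge` — hence `∑_{n≤Y, R-free} g(n) ≥ (1 − ∑_{p∈R} ∑_k g(p^k)) G(Y)`;
* `sub_mul_esymm_le`, `pow_le_factorial_mul_esymm`, `sum_le_of_esymm_le` — for weights
  `0 ≤ w_p ≤ w_max` on `R` with sum `S`: `(S − m w_max) e_m ≤ (m+1) e_{m+1}`, hence
  `(S − (m−1) w_max)^m ≤ m! e_m` and `S ≤ m ρ^{1/m} + (m−1) w_max` whenever `e_m ≤ ρ`.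

## References

* T. Tao, J. Teräväinen, *The Hardy–Littlewood–Chowla conjecture in the presence of a Siegel
  zero*, J. London Math. Soc. 106 (2022), §3.3, proof of Proposition 3.5. [TaoTeravainen2021]
-/

noncomputable section

open Finset ArithmeticFunction

namespace Literature.NumberTheory.LFunctions.SiegelZero

variable {g : ArithmeticFunction ℝ}

/-! ### Products with one large prime -/

/-- **`G(Y)(1 + ∑_{Y<p≤Z} g(p)) ≤ G(YZ)`** for a multiplicative `g ≥ 0`: the integers `n ≤ Y`
and the products `n p` (`n ≤ Y < p ≤ Z`, `p` prime) are pairwise distinct elements of `[1, YZ]`,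
and `g(np) = g(n) g(p)`. [cite: TaoTeravainen2021, §3.3 proof of Proposition 3.5] -/
theorem sum_Icc_mul_one_add_sum_prime_le (hg : g.IsMultiplicative) (hg0 : ∀ n, 0 ≤ g n)
    {Y Z : ℕ} (hY : 1 ≤ Y) (hYZ : Y ≤ Z) :
    (∑ n ∈ Icc 1 Y, g n) * (1 + ∑ p ∈ (Ioc Y Z).filter Nat.Prime, g p) ≤
      ∑ n ∈ Icc 1 (Y * Z), g n := by
  classical
  set P := (Ioc Y Z).filter Nat.Prime with hP
  set S := ((Icc 1 Y) ×ˢ P).image (fun x : ℕ × ℕ => x.1 * x.2) with hS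
  have hinj : Set.InjOn (fun x : ℕ × ℕ => x.1 * x.2) ↑((Icc 1 Y) ×ˢ P) := by
    rintro ⟨n, p⟩ hx ⟨n', p'⟩ hx' h
    simp only [Finset.coe_product, Set.mem_prod, Finset.mem_coe, Finset.mem_Icc, hP,
      Finset.mem_filter, Finset.mem_Ioc] at hx hx'
    change n * p = n' * p' at h
    have hp : p.Prime := hx.2.2
    have hp' : p'.Prime := hx'.2.2
    have hdvd : p ∣ n' * p' := ⟨n, by rw [← h]; ring⟩
    have hpn' : ¬ p ∣ n' := fun hd => absurd (Nat.le_of_dvd (by omega) hd) (by omega)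
    have hpp' : p = p' :=
      (Nat.prime_dvd_prime_iff_eq hp hp').mp ((hp.dvd_mul.mp hdvd).resolve_left hpn')
    subst hpp'
    have hnn' : n = n' := Nat.eq_of_mul_eq_mul_right hp.pos h
    subst hnn'
    rfl
  have hSsub : S ⊆ Ioc Y (Y * Z) := by
    intro s hs
    simp only [hS, Finset.mem_image, Finset.mem_product, Finset.mem_Icc, hP, Finset.mem_filter,
      Finset.mem_Ioc, Prod.exists] at hs
    obtain ⟨n, p, ⟨⟨hn1, hnY⟩, ⟨hYp, hpZ⟩, -⟩, rfl⟩ := hs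
    simp only [Finset.mem_Ioc]
    exact ⟨lt_of_lt_of_le hYp (Nat.le_mul_of_pos_left p hn1), Nat.mul_le_mul hnY hpZ⟩
  have hdisj : Disjoint (Icc 1 Y) S := by
    rw [Finset.disjoint_left]
    intro a ha haS
    have h1 := hSsub haS
    simp only [Finset.mem_Ioc] at h1
    simp only [Finset.mem_Icc] at ha
    omega
  have hLHS : (∑ n ∈ Icc 1 Y, g n) * (1 + ∑ p ∈ P, g p) =
      ∑ n ∈ Icc 1 Y, g n + ∑ s ∈ S, g s := by
    rw [mul_add, mul_one, hS, Finset.sum_image hinj, Finset.sum_product, Finset.sum_mul]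
    congr 1
    refine Finset.sum_congr rfl fun n hn => ?_
    rw [Finset.mul_sum]
    refine Finset.sum_congr rfl fun p hp => ?_
    simp only [hP, Finset.mem_filter, Finset.mem_Ioc] at hp
    simp only [Finset.mem_Icc] at hn
    have hcop : n.Coprime p := Nat.Coprime.symm
      ((Nat.Prime.coprime_iff_not_dvd hp.2).mpr
        (fun hd => absurd (Nat.le_of_dvd (by omega) hd) (by omega)))
    exact (hg.map_mul_of_coprime hcop).symm
  rw [hLHS, ← Finset.sum_union hdisj]
  apply Finset.sum_le_sum_of_subset_of_nonneg
  · apply Finset.union_subset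
    · exact Finset.Icc_subset_Icc_right (Nat.le_mul_of_pos_right Y (by omega))
    · exact hSsub.trans fun s hs => by
        simp only [Finset.mem_Ioc] at hs
        simp only [Finset.mem_Icc]
        omega
  · intro n _ _
    exact hg0 n

/-! ### Products with `m` primes from a window, over integers free of the window -/

/-- For `n` free of the primes of `R` and `P ⊆ R`, a prime `p ∈ R` divides `n ∏ P` iff `p ∈ P`.
[folklore] -/
theorem prime_dvd_mul_prod_iff {R P : Finset ℕ} (hR : ∀ p ∈ R, p.Prime) {n : ℕ}
    (hfree : ∀ p ∈ R, ¬ p ∣ n) (hP : P ⊆ R) {p : ℕ} (hp : p ∈ R) :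
    p ∣ n * ∏ r ∈ P, r ↔ p ∈ P := by
  have hpp : p.Prime := hR p hp
  rw [hpp.dvd_mul, Prime.dvd_finsetProd_iff hpp.prime]
  constructor
  · rintro (h1 | ⟨r, hr, hpr⟩)
    · exact absurd h1 (hfree p hp)
    · rwa [(Nat.prime_dvd_prime_iff_eq hpp (hR r (hP hr))).mp hpr]
  · intro hpP
    exact Or.inr ⟨p, hpP, dvd_rfl⟩

/-- **The `m`-fold products** (rigorous form of the display in the proof of Tao–Teräväinen's
(3.13)): let `g ≥ 0` be multiplicative, `R` a finite set of primes, `m, Y, U` such that every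
`m`-subset `P ⊆ R` has `∏ P > Y` and `n ∏ P ≤ U` for all `n ≤ Y`. Then
`(∑_{n ≤ Y, (n, R) = 1} g(n)) · ∑_{P ⊆ R, |P| = m} ∏_{p ∈ P} g(p) ≤ ∑_{Y < N ≤ U} g(N)`:
the map `(n, P) ↦ n ∏ P` is injective on such pairs (the primes of `R` dividing `n ∏ P` are
exactly those of `P`), lands in `(Y, U]`, and `g(n ∏ P) = g(n) ∏ g(p)`.
[cite: TaoTeravainen2021, §3.3 proof of Proposition 3.5] -/
theorem sum_free_mul_esymm_le (hg : g.IsMultiplicative) (hg0 : ∀ n, 0 ≤ g n)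
    {R : Finset ℕ} (hR : ∀ p ∈ R, p.Prime) {m Y U : ℕ}
    (hlow : ∀ P ∈ R.powersetCard m, Y < ∏ p ∈ P, p)
    (hup : ∀ n ∈ Icc 1 Y, ∀ P ∈ R.powersetCard m, n * ∏ p ∈ P, p ≤ U) :
    (∑ n ∈ (Icc 1 Y).filter (fun n => ∀ p ∈ R, ¬ p ∣ n), g n) *
        (∑ P ∈ R.powersetCard m, ∏ p ∈ P, g p) ≤ ∑ N ∈ Ioc Y U, g N := by
  classical
  set B := (Icc 1 Y).filter (fun n => ∀ p ∈ R, ¬ p ∣ n) with hB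
  set F : ℕ × Finset ℕ → ℕ := fun x => x.1 * ∏ p ∈ x.2, p with hF
  have hinj : Set.InjOn F ↑(B ×ˢ R.powersetCard m) := by
    rintro ⟨n, P⟩ hx ⟨n', P'⟩ hx' h
    simp only [coe_product, Set.mem_prod, mem_coe, hB, mem_filter, mem_Icc,
      mem_powersetCard] at hx hx'
    change n * ∏ p ∈ P, p = n' * ∏ p ∈ P', p at h
    have hPP' : P = P' := by
      ext p
      constructor
      · intro hpP
        have hpR : p ∈ R := hx.2.1 hpP
        have h1 : p ∣ n * ∏ r ∈ P, r := (prime_dvd_mul_prod_iff hR hx.1.2 hx.2.1 hpR).mpr hpP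
        rw [h] at h1
        exact (prime_dvd_mul_prod_iff hR hx'.1.2 hx'.2.1 hpR).mp h1
      · intro hpP'
        have hpR : p ∈ R := hx'.2.1 hpP'
        have h1 : p ∣ n' * ∏ r ∈ P', r :=
          (prime_dvd_mul_prod_iff hR hx'.1.2 hx'.2.1 hpR).mpr hpP'
        rw [← h] at h1
        exact (prime_dvd_mul_prod_iff hR hx.1.2 hx.2.1 hpR).mp h1
    subst hPP'
    have hprod : 0 < ∏ p ∈ P, p := Finset.prod_pos fun p hp => (hR p (hx.2.1 hp)).pos
    have hnn' : n = n' := Nat.eq_of_mul_eq_mul_right hprod h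
    subst hnn'
    rfl
  have hval : ∀ x ∈ B ×ˢ R.powersetCard m, g (F x) = g x.1 * ∏ p ∈ x.2, g p := by
    rintro ⟨n, P⟩ hx
    simp only [mem_product, hB, mem_filter, mem_Icc, mem_powersetCard] at hx
    have hPprime : ∀ p ∈ P, p.Prime := fun p hp => hR p (hx.2.1 hp)
    have hcop : Nat.Coprime n (∏ p ∈ P, p) :=
      Nat.Coprime.prod_right fun p hp => Nat.Coprime.symm
        ((Nat.Prime.coprime_iff_not_dvd (hPprime p hp)).mpr (hx.1.2 p (hx.2.1 hp)))
    change g (n * ∏ p ∈ P, p) = g n * ∏ p ∈ P, g p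
    rw [hg.map_mul_of_coprime hcop, hg.map_prod_of_prime P hPprime]
  have hsub : (B ×ˢ R.powersetCard m).image F ⊆ Ioc Y U := by
    intro N hN
    rw [mem_image] at hN
    obtain ⟨⟨n, P⟩, hx, rfl⟩ := hN
    have hx' := hx
    simp only [mem_product, hB, mem_filter, mem_Icc, mem_powersetCard] at hx'
    rw [mem_Ioc]
    constructor
    · calc Y < ∏ p ∈ P, p := hlow P (mem_powersetCard.mpr hx'.2)
        _ ≤ n * ∏ p ∈ P, p := Nat.le_mul_of_pos_left _ hx'.1.1.1
    · exact hup n (mem_Icc.mpr hx'.1.1) P (mem_powersetCard.mpr hx'.2)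
  calc (∑ n ∈ B, g n) * (∑ P ∈ R.powersetCard m, ∏ p ∈ P, g p)
      = ∑ x ∈ B ×ˢ R.powersetCard m, g x.1 * ∏ p ∈ x.2, g p := by
        rw [Finset.sum_product, Finset.sum_mul_sum]
    _ = ∑ x ∈ B ×ˢ R.powersetCard m, g (F x) := Finset.sum_congr rfl fun x hx => (hval x hx).symm
    _ = ∑ N ∈ (B ×ˢ R.powersetCard m).image F, g N := (Finset.sum_image hinj).symm
    _ ≤ ∑ N ∈ Ioc Y U, g N := Finset.sum_le_sum_of_subset_of_nonneg hsub fun N _ _ => hg0 N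

/-! ### The one-prime sieve -/

/-- **The one-prime sieve**: for a multiplicative `g ≥ 0`, a prime `p` and `Y ≥ 0`,
`∑_{n ≤ Y, p ∣ n} g(n) ≤ (∑_{1 ≤ k ≤ Y} g(p^k)) · ∑_{n ≤ Y} g(n)` (write `n = p^k m`, `p ∤ m`,
`k = v_p(n) ∈ [1, Y]`; for fixed `k` the map `n ↦ m` is injective and `g(n) = g(p^k) g(m)`).
[folklore] -/
theorem sum_filter_dvd_le (hg : g.IsMultiplicative) (hg0 : ∀ n, 0 ≤ g n) {p : ℕ}
    (hp : p.Prime) (Y : ℕ) :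
    ∑ n ∈ (Icc 1 Y).filter (fun n => p ∣ n), g n ≤
      (∑ k ∈ Icc 1 Y, g (p ^ k)) * ∑ n ∈ Icc 1 Y, g n := by
  classical
  have hmaps : ∀ n ∈ (Icc 1 Y).filter (fun n => p ∣ n), n.factorization p ∈ Icc 1 Y := by
    intro n hn
    simp only [mem_filter, mem_Icc] at hn
    rw [mem_Icc]
    constructor
    · exact (hp.dvd_iff_one_le_factorization (by omega)).mp hn.2
    · exact (Nat.factorization_lt p (by omega)).le.trans hn.1.2
  rw [← Finset.sum_fiberwise_of_maps_to hmaps, Finset.sum_mul]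
  refine Finset.sum_le_sum fun k _ => ?_
  set Fk := ((Icc 1 Y).filter (fun n => p ∣ n)).filter (fun n => n.factorization p = k) with hFk
  have hdecomp : ∀ n ∈ Fk, n = p ^ k * (n / p ^ k) ∧ ¬ p ∣ n / p ^ k ∧
      1 ≤ n / p ^ k ∧ n / p ^ k ≤ Y := by
    intro n hn
    simp only [hFk, mem_filter, mem_Icc] at hn
    obtain ⟨⟨⟨hn1, hnY⟩, -⟩, hk⟩ := hn
    have hn0 : n ≠ 0 := by omega
    have h1 := Nat.ordProj_mul_ordCompl_eq_self n p
    have h2 := Nat.not_dvd_ordCompl hp hn0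
    have h3 := Nat.ordCompl_pos p hn0
    rw [hk] at h1 h2 h3
    exact ⟨h1.symm, h2, h3, (Nat.div_le_self n _).trans hnY⟩
  have hval : ∀ n ∈ Fk, g n = g (p ^ k) * g (n / p ^ k) := by
    intro n hn
    obtain ⟨e, hnd, -, -⟩ := hdecomp n hn
    have hcop : Nat.Coprime (p ^ k) (n / p ^ k) :=
      ((Nat.Prime.coprime_iff_not_dvd hp).mpr hnd).pow_left k
    conv_lhs => rw [e]
    exact hg.map_mul_of_coprime hcop
  have hinj : Set.InjOn (fun n => n / p ^ k) ↑Fk := by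
    intro n hn n' hn' h
    change n / p ^ k = n' / p ^ k at h
    obtain ⟨e, -⟩ := hdecomp n hn
    obtain ⟨e', -⟩ := hdecomp n' hn'
    calc n = p ^ k * (n / p ^ k) := e
      _ = p ^ k * (n' / p ^ k) := by rw [h]
      _ = n' := e'.symm
  have himg : Fk.image (fun n => n / p ^ k) ⊆ Icc 1 Y := by
    intro m hm
    rw [mem_image] at hm
    obtain ⟨n, hn, rfl⟩ := hm
    obtain ⟨-, -, h1, h2⟩ := hdecomp n hn
    exact mem_Icc.mpr ⟨h1, h2⟩
  calc ∑ n ∈ Fk, g n = ∑ n ∈ Fk, g (p ^ k) * g (n / p ^ k) := Finset.sum_congr rfl hval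
    _ = g (p ^ k) * ∑ m ∈ Fk.image (fun n => n / p ^ k), g m := by
        rw [Finset.mul_sum, Finset.sum_image hinj]
    _ ≤ g (p ^ k) * ∑ m ∈ Icc 1 Y, g m :=
        mul_le_mul_of_nonneg_left
          (Finset.sum_le_sum_of_subset_of_nonneg himg fun _ _ _ => hg0 _) (hg0 _)

/-- **Integers free of a set of primes carry most of the weight**: for a multiplicative `g ≥ 0`
and a finite set `R` of primes,
`(1 − ∑_{p ∈ R} ∑_{1 ≤ k ≤ Y} g(p^k)) · ∑_{n ≤ Y} g(n) ≤ ∑_{n ≤ Y, (n,R)=1} g(n)`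
(union bound and the one-prime sieve). [folklore] -/
theorem sum_free_ge (hg : g.IsMultiplicative) (hg0 : ∀ n, 0 ≤ g n) {R : Finset ℕ}
    (hR : ∀ p ∈ R, p.Prime) (Y : ℕ) :
    (1 - ∑ p ∈ R, ∑ k ∈ Icc 1 Y, g (p ^ k)) * ∑ n ∈ Icc 1 Y, g n ≤
      ∑ n ∈ (Icc 1 Y).filter (fun n => ∀ p ∈ R, ¬ p ∣ n), g n := by
  classical
  have hsplit := Finset.sum_filter_add_sum_filter_not (Icc 1 Y) (fun n => ∀ p ∈ R, ¬ p ∣ n) g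
  have hbad : ∑ n ∈ (Icc 1 Y).filter (fun n => ¬ ∀ p ∈ R, ¬ p ∣ n), g n ≤
      ∑ p ∈ R, ∑ n ∈ (Icc 1 Y).filter (fun n => p ∣ n), g n := by
    rw [Finset.sum_filter]
    simp_rw [Finset.sum_filter]
    rw [Finset.sum_comm]
    refine Finset.sum_le_sum fun n _ => ?_
    have hnonneg : ∀ r ∈ R, 0 ≤ (if r ∣ n then g n else 0) := fun r _ => by
      split_ifs <;> simp [hg0]
    split_ifs with h
    · exact Finset.sum_nonneg hnonneg
    · push Not at h
      obtain ⟨p, hp, hpn⟩ := h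
      calc g n = if p ∣ n then g n else 0 := by rw [if_pos hpn]
        _ ≤ ∑ p ∈ R, if p ∣ n then g n else 0 :=
          Finset.single_le_sum (f := fun p => if p ∣ n then g n else 0) hnonneg hp
  have hsieve : ∑ p ∈ R, ∑ n ∈ (Icc 1 Y).filter (fun n => p ∣ n), g n ≤
      ∑ p ∈ R, (∑ k ∈ Icc 1 Y, g (p ^ k)) * ∑ n ∈ Icc 1 Y, g n :=
    Finset.sum_le_sum fun p hp => sum_filter_dvd_le hg hg0 (hR p hp) Y
  rw [← Finset.sum_mul] at hsieve
  nlinarith [hsplit, hbad, hsieve]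

/-! ### Elementary symmetric means -/

/-- **Newton-type inequality for elementary symmetric sums**: for weights `0 ≤ w_p ≤ w_max` on a
finite set `R` with `S = ∑_{p∈R} w_p` and `e_m = ∑_{P ⊆ R, |P| = m} ∏_{p ∈ P} w_p`,
`(S − m w_max) e_m ≤ (m+1) e_{m+1}`: indeed `S e_m = ∑_Q ∑_{p ∉ Q} w_p w^Q + ∑_Q ∑_{p∈Q} w_p w^Q`,
the first sum is `(m+1) e_{m+1}` (each `(m+1)`-set arises from its `m+1` elements) and the second
is `≤ m w_max e_m`. [folklore] -/
theorem sub_mul_esymm_le {R : Finset ℕ} {w : ℕ → ℝ} {wmax : ℝ} (hw0 : ∀ p ∈ R, 0 ≤ w p)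
    (hwm : ∀ p ∈ R, w p ≤ wmax) (m : ℕ) :
    ((∑ p ∈ R, w p) - m * wmax) * (∑ Q ∈ R.powersetCard m, ∏ p ∈ Q, w p) ≤
      (m + 1) * ∑ P ∈ R.powersetCard (m + 1), ∏ p ∈ P, w p := by
  classical
  have hprod0 : ∀ Q ∈ R.powersetCard m, 0 ≤ ∏ p ∈ Q, w p := fun Q hQ =>
    Finset.prod_nonneg fun p hp => hw0 p ((mem_powersetCard.mp hQ).1 hp)
  -- `S e_m = ∑_Q (∑_{p ∈ R \ Q} + ∑_{p ∈ Q}) w_p w^Q`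
  have hexpand : (∑ p ∈ R, w p) * (∑ Q ∈ R.powersetCard m, ∏ p ∈ Q, w p) =
      ∑ Q ∈ R.powersetCard m, ∑ p ∈ R \ Q, w p * ∏ r ∈ Q, w r +
        ∑ Q ∈ R.powersetCard m, ∑ p ∈ Q, w p * ∏ r ∈ Q, w r := by
    rw [Finset.mul_sum, ← Finset.sum_add_distrib]
    refine Finset.sum_congr rfl fun Q hQ => ?_
    have hQR : Q ⊆ R := (mem_powersetCard.mp hQ).1
    rw [← Finset.sum_mul, ← Finset.sum_mul, ← add_mul, Finset.sum_sdiff hQR]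
  -- the second double sum is `≤ m w_max e_m`
  have hsecond : ∑ Q ∈ R.powersetCard m, ∑ p ∈ Q, w p * ∏ r ∈ Q, w r ≤
      m * wmax * ∑ Q ∈ R.powersetCard m, ∏ p ∈ Q, w p := by
    rw [Finset.mul_sum]
    refine Finset.sum_le_sum fun Q hQ => ?_
    obtain ⟨hQR, hcard⟩ := mem_powersetCard.mp hQ
    rw [← Finset.sum_mul]
    refine mul_le_mul_of_nonneg_right ?_ (hprod0 Q hQ)
    calc ∑ p ∈ Q, w p ≤ ∑ _p ∈ Q, wmax := Finset.sum_le_sum fun p hp => hwm p (hQR hp)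
      _ = m * wmax := by rw [Finset.sum_const, hcard, nsmul_eq_mul]
  -- the first double sum is `(m+1) e_{m+1}`
  have hfirst : ∑ Q ∈ R.powersetCard m, ∑ p ∈ R \ Q, w p * ∏ r ∈ Q, w r =
      (m + 1) * ∑ P ∈ R.powersetCard (m + 1), ∏ p ∈ P, w p := by
    -- both equal `∑_{(P, p) : p ∈ P} w^P`, `P` an `(m+1)`-subset
    have hRHS : (m + 1 : ℝ) * ∑ P ∈ R.powersetCard (m + 1), ∏ p ∈ P, w p =
        ∑ P ∈ R.powersetCard (m + 1), ∑ _p ∈ P, ∏ r ∈ P, w r := by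
      rw [Finset.mul_sum]
      refine Finset.sum_congr rfl fun P hP => ?_
      rw [Finset.sum_const, (mem_powersetCard.mp hP).2, nsmul_eq_mul]
      push_cast
      ring
    rw [hRHS, Finset.sum_sigma', Finset.sum_sigma']
    refine Finset.sum_bij' (fun x _ => ⟨insert x.2 x.1, x.2⟩) (fun y _ => ⟨y.1.erase y.2, y.2⟩)
      ?_ ?_ ?_ ?_ ?_
    · rintro ⟨Q, p⟩ hx
      simp only [Finset.mem_sigma, mem_powersetCard, Finset.mem_sdiff] at hx ⊢
      obtain ⟨⟨hQR, hcard⟩, hpR, hpQ⟩ := hx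
      exact ⟨⟨Finset.insert_subset hpR hQR, by rw [Finset.card_insert_of_notMem hpQ, hcard]⟩,
        Finset.mem_insert_self _ _⟩
    · rintro ⟨P, p⟩ hy
      simp only [Finset.mem_sigma, mem_powersetCard, Finset.mem_sdiff] at hy ⊢
      obtain ⟨⟨hPR, hcard⟩, hpP⟩ := hy
      exact ⟨⟨(Finset.erase_subset _ _).trans hPR, by rw [Finset.card_erase_of_mem hpP, hcard]; simp⟩,
        hPR hpP, Finset.notMem_erase _ _⟩
    · rintro ⟨Q, p⟩ hx
      simp only [Finset.mem_sigma, mem_powersetCard, Finset.mem_sdiff] at hx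
      simp [Finset.erase_insert hx.2.2]
    · rintro ⟨P, p⟩ hy
      simp only [Finset.mem_sigma, mem_powersetCard] at hy
      simp [Finset.insert_erase hy.2]
    · rintro ⟨Q, p⟩ hx
      simp only [Finset.mem_sigma, mem_powersetCard, Finset.mem_sdiff] at hx
      simp only
      rw [Finset.prod_insert hx.2.2]
  rw [sub_mul, hexpand, hfirst]
  linarith

/-- **`(S − (m−1) w_max)^m ≤ m! e_m`** for weights `0 ≤ w_p ≤ w_max` on `R` with
`S = ∑ w_p ≥ (m−1) w_max` (iterate `sub_mul_esymm_le`). [folklore] -/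
theorem pow_le_factorial_mul_esymm {R : Finset ℕ} {w : ℕ → ℝ} {wmax : ℝ}
    (hw0 : ∀ p ∈ R, 0 ≤ w p) (hwm : ∀ p ∈ R, w p ≤ wmax) (hwmax : 0 ≤ wmax) :
    ∀ m : ℕ, ((m : ℝ) - 1) * wmax ≤ ∑ p ∈ R, w p →
      ((∑ p ∈ R, w p) - ((m : ℝ) - 1) * wmax) ^ m ≤
        m.factorial * ∑ P ∈ R.powersetCard m, ∏ p ∈ P, w p := by
  intro m
  induction m with
  | zero =>
    intro _
    simp
  | succ m ih =>
    intro hS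
    push_cast at hS ⊢
    have hS' : ((m : ℝ) - 1) * wmax ≤ ∑ p ∈ R, w p := by nlinarith
    have h1 := ih hS'
    have h2 := sub_mul_esymm_le hw0 hwm m
    have hA : 0 ≤ ∑ p ∈ R, w p - m * wmax := by linarith
    have hB : ∑ p ∈ R, w p - m * wmax ≤ ∑ p ∈ R, w p - ((m : ℝ) - 1) * wmax := by nlinarith
    have hfac : ((m + 1).factorial : ℝ) = (m + 1) * m.factorial := by
      rw [Nat.factorial_succ]; push_cast; ring
    calc (∑ p ∈ R, w p - (m + 1 - 1) * wmax) ^ (m + 1)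
        = (∑ p ∈ R, w p - m * wmax) * (∑ p ∈ R, w p - m * wmax) ^ m := by ring
      _ ≤ (∑ p ∈ R, w p - m * wmax) * (∑ p ∈ R, w p - ((m : ℝ) - 1) * wmax) ^ m := by
          gcongr
      _ ≤ (∑ p ∈ R, w p - m * wmax) * (m.factorial * ∑ P ∈ R.powersetCard m, ∏ p ∈ P, w p) :=
          mul_le_mul_of_nonneg_left h1 hA
      _ = m.factorial * ((∑ p ∈ R, w p - m * wmax) * ∑ P ∈ R.powersetCard m, ∏ p ∈ P, w p) := by
          ring
      _ ≤ m.factorial * ((m + 1) * ∑ P ∈ R.powersetCard (m + 1), ∏ p ∈ P, w p) :=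
          mul_le_mul_of_nonneg_left h2 (by positivity)
      _ = ((m + 1).factorial : ℝ) * ∑ P ∈ R.powersetCard (m + 1), ∏ p ∈ P, w p := by
          rw [hfac]; ring

/-- **Solving for `S`**: for weights `0 ≤ w_p ≤ w_max` on `R`, `m ≥ 1` and `e_m ≤ ρ` (`ρ ≥ 0`),
`S = ∑ w_p ≤ m ρ^{1/m} + (m−1) w_max` (from `(S − (m−1)w_max)^m ≤ m! e_m ≤ m^m ρ`). [folklore] -/
theorem sum_le_of_esymm_le {R : Finset ℕ} {w : ℕ → ℝ} {wmax ρ : ℝ}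
    (hw0 : ∀ p ∈ R, 0 ≤ w p) (hwm : ∀ p ∈ R, w p ≤ wmax) (hwmax : 0 ≤ wmax) (hρ : 0 ≤ ρ)
    {m : ℕ} (hm : 1 ≤ m) (he : ∑ P ∈ R.powersetCard m, ∏ p ∈ P, w p ≤ ρ) :
    ∑ p ∈ R, w p ≤ m * ρ ^ (1 / (m : ℝ)) + ((m : ℝ) - 1) * wmax := by
  set S := ∑ p ∈ R, w p with hSdef
  rcases lt_or_ge S (((m : ℝ) - 1) * wmax) with hlt | hge
  · have : 0 ≤ (m : ℝ) * ρ ^ (1 / (m : ℝ)) := by positivity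
    linarith
  have hm0 : (m : ℝ) ≠ 0 := by exact_mod_cast (by omega : m ≠ 0)
  have hmpos : (0 : ℝ) < m := by exact_mod_cast hm
  have h1 := pow_le_factorial_mul_esymm hw0 hwm hwmax m hge
  have hfac : (m.factorial : ℝ) ≤ (m : ℝ) ^ m := by exact_mod_cast Nat.factorial_le_pow m
  have h2 : (S - ((m : ℝ) - 1) * wmax) ^ m ≤ ((m : ℝ) * ρ ^ (1 / (m : ℝ))) ^ m := by
    calc (S - ((m : ℝ) - 1) * wmax) ^ m ≤ m.factorial * ∑ P ∈ R.powersetCard m, ∏ p ∈ P, w p := h1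
      _ ≤ (m : ℝ) ^ m * ρ := mul_le_mul hfac he
          (Finset.sum_nonneg fun Q hQ => Finset.prod_nonneg fun p hp =>
            hw0 p ((mem_powersetCard.mp hQ).1 hp)) (by positivity)
      _ = ((m : ℝ) * ρ ^ (1 / (m : ℝ))) ^ m := by
          rw [mul_pow, ← Real.rpow_natCast (ρ ^ (1 / (m : ℝ))) m, ← Real.rpow_mul hρ,
            one_div, inv_mul_cancel₀ hm0, Real.rpow_one]
  have h3 : S - ((m : ℝ) - 1) * wmax ≤ (m : ℝ) * ρ ^ (1 / (m : ℝ)) :=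
    le_of_pow_le_pow_left₀ (by omega : m ≠ 0) (by positivity) h2
  linarith

end Literature.NumberTheory.LFunctions.SiegelZero

end
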